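import Literature.AlgebraicGeometry.ShimuraVarieties.UnitaryBallH1RestrictionImageOfSource
import Literature.AlgebraicGeometry.ShimuraVarieties.UnitaryBallSubBallMorphism
import Literature.AlgebraicGeometry.HodgeTheory.ComplexConjugationHolds
import Literature.NumberTheory.Transcendental.AnalytificationMorphismsProofs
import HarnessLib

/-!
# Compatible uniformised special curves from the linear-algebra clauses alone ([Liu 2021] proof of Thm. 4.15, l. 2207;
# [BMM 2016] Part 2 §§3.1–3.3: the sub-ball `𝔹(W^⊥) → 𝔹²` descends to a morphism of the compact quotients)

Topic `AlgebraicGeometry/ShimuraVarieties`, namespace `Literature.AlgebraicGeometry.ShimuraVarieties` (sub-namespaces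
`UnitaryBallUniformisationDatum`, `UnitaryBallQuotientDatum`). THEOREMS ONLY (no definition, no named fact, no instance, no `sorry`).

★ `IsCompatibleSpecialSource D W D₁ φ M` (`UnitaryBallH1RestrictionToSpecialCurves` §III-8′) asks of a compatible uniformised special
curve `(Y, D₁, φ, M)` over `(D, W)` four clauses: `gram` (`Mᴴ H^{τ₁} M = H₁^{τ₁}`), `orthogonal` (`M(ℂ²) ⟂ W`), `group` (every `γ₁ ∈ Γ₁`
is the restriction of some `γ ∈ Γ` along `M`) and `unif_comp` (`φ(ℂ)(unif₁ v) = unif (M v)` on the negative cone).  The last clause,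
TOGETHER WITH THE MORPHISM `φ : Y ⟶ X` itself, is a CONSEQUENCE of the first and third: the sub-ball translation `[v] ↦ [M v]` is a
`ℂ`-morphism of the smooth projective models (★ `UnitaryBallSubBallMorphism.exists_hom_map_unif_mulVec_eq_of_gram`: holomorphy through
local sections of the disc uniformisation, local injectivity of the source from the discontinuity of `Γ` on `𝔹²`, and GAGA for
morphisms ★ `arapura2012_cor_15_4_6_holds`; Hodge models ★ `exists_isReal_hodgeModel_holds`).  Hence:

* `UnitaryBallUniformisationDatum.exists_isCompatibleSpecialSource_of_gram` — `gram` + `orthogonal` + `group` for `(Y, D₁, M)` give a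
  `φ : Y ⟶ X` with `D.IsCompatibleSpecialSource W D₁ φ M`;
* `UnitaryBallQuotientDatum.mr92Prop6_of_forall_exists_gram_group` — the IMAGE form ★ `MR92Prop6 D` (row III-8) follows as soon as
  every totally positive definite `E`-line `W` carries a uniformised curve `(Y, D₁)` and a matrix `M` with the three matrix clauses
  (★ `mr92Prop6_of_forall_exists_compatibleSpecialSource`, whose source form ★ `mr92Prop6Source` is a theorem): what the «one compatible
  triple per line» hypothesis owes is ONLY the algebraic uniformised curve `Γ_W∖𝔻` with its frame — no morphism, no GAGA at the consumer
  (the cell hodgecm-mathlib's road (ii) R2-2 «special curve datum»).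

## References
* [Liu2021] Y. Liu, Camb. J. Math. 9 (2021), proof of Thm. 4.15, l. 2207 and l. 2212 (footnote 9).
* [BergeronMillsonMoeglin2016Balls] N. Bergeron, J. Millson, C. Moeglin, Acta Math. 216 (2016), Part 2 §§3.1–3.3.
* [MurtyRamakrishnan1992] V. K. Murty, D. Ramakrishnan, CRM Montréal (1992), §5 Prop. 6 p. 460.
* [Arapura2012] D. Arapura, *Algebraic Geometry over the Complex Numbers* (2012), Cor. 15.4.6.
-/

set_option autoImplicit false

noncomputable section

open CategoryTheory Matrix Set

namespace Literature.AlgebraicGeometry.ShimuraVarieties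

open Literature.AlgebraicGeometry.Motives (SchemeOver ComplexPoints AlgPoints)
open Literature.AlgebraicGeometry.HodgeTheory (HodgeModel)
open Literature.NumberTheory.Transcendental (arapura2012_cor_15_4_6_holds)

variable {X Y : SchemeOver ℂ}

namespace UnitaryBallUniformisationDatum

/-- **Compatible special sources from the linear-algebra clauses**: for a ball quotient `D` (rank `2`), an `E`-subspace `W`, a disc
quotient `D₁` uniformising `Y(ℂ)` and a `3 × 2` complex matrix `M` with `gram` (`Mᴴ H^{τ₁} M = H₁^{τ₁}`), `orthogonal` (`M(ℂ²) ⟂ τ₁W`)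
and `group` (each `γ₁ ∈ Γ₁` restricted from some `γ ∈ Γ` along `M`), there is a `ℂ`-morphism `φ : Y ⟶ X` making `(Y, D₁, φ, M)` a
compatible uniformised special curve over `(D, W)` — `φ` and the `unif_comp` clause are ★ `exists_hom_map_unif_mulVec_eq_of_gram`
(Arapura ★ `arapura2012_cor_15_4_6_holds`, Hodge models ★ `exists_isReal_hodgeModel_holds`).
[cite: Liu2021, proof of Thm. 4.15, l. 2207] [cite: BergeronMillsonMoeglin2016Balls, Part 2 §§3.1–3.3] [cite: Arapura2012, §15.4 Cor. 15.4.6] -/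
theorem exists_isCompatibleSpecialSource_of_gram (D : UnitaryBallUniformisationDatum 2 X) (W : Submodule D.E (Fin 3 → D.E))
    (D₁ : UnitaryBallUniformisationDatum 1 Y) (M : Matrix (Fin 3) (Fin 2) ℂ)
    (gram : M.conjTranspose * D.H.map D.E.subtype * M = D₁.H.map D₁.E.subtype)
    (orthogonal : ∀ w ∈ W, ∀ v : Fin 2 → ℂ,
      hermForm (starRingEnd ℂ) (D.H.map D.E.subtype) (fun i => (w i : ℂ)) (M.mulVec v) = 0)
    (group : ∀ γ₁ ∈ D₁.Γ, ∃ γ ∈ D.Γ,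
      (γ : Matrix (Fin 3) (Fin 3) D.E).map D.E.subtype * M = M * (γ₁ : Matrix (Fin 2) (Fin 2) D₁.E).map D₁.E.subtype) :
    ∃ φ : Y ⟶ X, D.IsCompatibleSpecialSource W D₁ φ M := by
  have hA₁ : Nonempty (HodgeModel 1 Y) :=
    let ⟨A, _⟩ := HodgeTheory.exists_isReal_hodgeModel_holds 1 Y D₁.isSmoothProjective; ⟨A⟩
  have hA₂ : Nonempty (HodgeModel 2 X) :=
    let ⟨A, _⟩ := HodgeTheory.exists_isReal_hodgeModel_holds 2 X D.isSmoothProjective; ⟨A⟩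
  obtain ⟨φ, hφ⟩ := UnitaryBallSubBallMorphism.exists_hom_map_unif_mulVec_eq_of_gram (D₁ := D₁) (D₂ := D) (M := M)
    arapura2012_cor_15_4_6_holds hA₁ hA₂ gram group
  exact ⟨φ, ⟨gram, orthogonal, group, hφ⟩⟩

end UnitaryBallUniformisationDatum

namespace UnitaryBallQuotientDatum

/-- **III-8 (`MR92Prop6`, image form) from uniformised special curves with the matrix clauses only**: if every totally positive definite
`E`-line `W ⊆ V` carries a disc quotient `(Y, D₁)` and a matrix `M` with `gram`, `orthogonal`, `group` over `(D, W)`, then every non-zero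
class in `H¹(X(ℂ); ℂ)` restricts non-trivially to the special curve of some totally positive line — ★
`mr92Prop6_of_forall_exists_compatibleSpecialSource` (over the proved source form ★ `mr92Prop6Source`) fed by
`exists_isCompatibleSpecialSource_of_gram`. [cite: MurtyRamakrishnan1992, §5 Prop. 6 p. 460, Lemma B p. 462, Cor. C pp. 462–463]
[cite: Liu2021, proof of Thm. 4.15, l. 2212 and footnote 9] -/
theorem mr92Prop6_of_forall_exists_gram_group (D : UnitaryBallQuotientDatum 2 X)
    (hex : ∀ W : Submodule D.E (Fin 3 → D.E), IsTotallyPositive (conjRingHom D.E) D.H W → Module.finrank D.E W = 1 →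
      ∃ (Y : SchemeOver ℂ) (D₁ : UnitaryBallUniformisationDatum 1 Y) (M : Matrix (Fin 3) (Fin 2) ℂ),
        M.conjTranspose * D.H.map D.E.subtype * M = D₁.H.map D₁.E.subtype ∧
        (∀ w ∈ W, ∀ v : Fin 2 → ℂ, hermForm (starRingEnd ℂ) (D.H.map D.E.subtype) (fun i => (w i : ℂ)) (M.mulVec v) = 0) ∧
        (∀ γ₁ ∈ D₁.Γ, ∃ γ ∈ D.Γ,
          (γ : Matrix (Fin 3) (Fin 3) D.E).map D.E.subtype * M = M * (γ₁ : Matrix (Fin 2) (Fin 2) D₁.E).map D₁.E.subtype)) :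
    MR92Prop6 D :=
  D.mr92Prop6_of_forall_exists_compatibleSpecialSource fun W hW h1 =>
    let ⟨Y, D₁, M, hg, ho, hgr⟩ := hex W hW h1
    let ⟨φ, hφ⟩ := D.toUnitaryBallUniformisationDatum.exists_isCompatibleSpecialSource_of_gram W D₁ M hg ho hgr
    ⟨Y, D₁, φ, M, hφ⟩

end UnitaryBallQuotientDatum

end Literature.AlgebraicGeometry.ShimuraVarieties

end
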